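import Mathlib
import HarnessLib
import Literature.Computability.AlgebraicComplexity.ArithCircuit
import Literature.Computability.AlgebraicComplexity.CircuitDepth
import Literature.Computability.AlgebraicComplexity.StandardFamilies
import Literature.Computability.AlgebraicComplexity.ValiantClasses
import Literature.Computability.AlgebraicComplexity.ConstantFreeCircuits
import Literature.Computability.AlgebraicComplexity.ArithCircuitComposition
import Literature.Computability.AlgebraicComplexity.ArithCircuitProjections
import Literature.Computability.AlgebraicComplexity.RealTauConjectureDepthFour
import Literature.Computability.AlgebraicComplexity.DepthThreeChasmCircuits
import Literature.Computability.AlgebraicComplexity.AndrewsForbes2022BorderComposition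
import Summits.ValiantsHypothesis.Statement
import Summits.ValiantsHypothesis.ValiantsHypothesis.Theorems.SuccinctLiftAlgebraicConstants

/-!
# SuccinctLift — binary numerals by sum gates; integer advice of polynomial bit length is free at
# fixed product depth (circuit form)

Support file for route `route-ValiantsHypothesis-SuccinctLift` (lens 2 of the Valiant decomposition
workshop), node `K_alg = AlgConstantLiftLog3`. In the Koiran–Perifel ADVICE presentation of constants
(a circuit with constants = a SIGN-constant integer circuit some of whose inputs are fed fixed scalars;
Koiran–Perifel 2011 §2, Bürgisser 2000 §4.3) this file proves the circuit-level rung used by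
`Theorems/SuccinctLiftIntegerAdvice.lean`:

* `binNumeral z L` — a constant circuit computing the integer `z` (`|z| ≤ 2^L`) made of SUM gates
  only: a doubling chain `1, 2, 4, …, 2^L` and one signed sum over the binary digits of `|z|`;
  constants and coefficients in `{0, ±1}` (`hasSignConstants_binNumeral`), product depth `0`
  (`productDepth_binNumeral`), at most `3L + 2` wires (`edgeSize_binNumeral_le`), value `C z`
  (`eval_binNumeral`) — Bürgisser 2009 §2.2 (`τ(k) ≤ 2 log₂ k`) in unbounded-fan-in, depth-aware form;
* `hasSignConstants_compose` — circuit composition keeps sign constants;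
* `exists_signConst_of_intAdvice` — a sign circuit `C(x, y)` with `m` integer advice leaves of bit
  length `L` is simulated (same polynomial, product depth not larger, `≤ m (3L + 2)` extra wires) by
  a sign circuit in `x` alone.

Elementary bookkeeping over the tree's `ArithCircuit` (`compose`, `substVC`, `gateWDepths`); no summit
statement is touched here.

References: KoiranPerifel2011 (§2), Burgisser2009 (§2.2), Burgisser2000 (§4.3).
-/

namespace Summit.ValiantsHypothesis.ValiantsHypothesis.Theorems.SuccinctLift

open Literature.Computability.AlgebraicComplexity MvPolynomial

/-! ### §1 Binary numerals made of sum gates only -/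

section Numerals

variable {τ : Type*}

/-- The doubling chain: gates `g₀, …, g_L` with `g₀ = 1·1` and `g_{j+1} = g_j + g_j`, so that
`g_j` computes the constant `2^j`; sum gates only, coefficients `1`. [cite: Burgisser2009, §2.2] -/
def pow2Gates : ℕ → List (ArithCircuit.Gate ℤ τ)
  | 0 => [.sum [(1, .const 1)]]
  | L + 1 => pow2Gates L ++ [.sum [(1, .gate L), (1, .gate L)]]

/-- The doubling chain has `L + 1` gates. [cite: Burgisser2009, §2.2] -/
@[simp] theorem length_pow2Gates (L : ℕ) :
    (pow2Gates L : List (ArithCircuit.Gate ℤ τ)).length = L + 1 := by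
  induction L with
  | zero => rfl
  | succ L ih => simp [pow2Gates, ih]

/-- Gate `j` of the doubling chain computes `2^j`. [cite: Burgisser2009, §2.2] -/
theorem gateValues_pow2Gates (L : ℕ) :
    ArithCircuit.gateValues (pow2Gates L : List (ArithCircuit.Gate ℤ τ)) =
      (List.range (L + 1)).map fun j => (C ((2 : ℤ) ^ j) : MvPolynomial τ ℤ) := by
  induction L with
  | zero =>
    change ArithCircuit.gateValues ([] ++ [_]) = _
    rw [ArithCircuit.gateValues_append_singleton]
    simp [ArithCircuit.gateValues, ArithCircuit.Gate.eval, ArithCircuit.Operand.eval, List.range_succ]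
  | succ L ih =>
    rw [pow2Gates, ArithCircuit.gateValues_append_singleton, ih, List.range_succ (n := L + 1),
      List.map_append, List.map_singleton]
    congr 1
    have hget : (((List.range (L + 1)).map fun j => (C ((2 : ℤ) ^ j) : MvPolynomial τ ℤ)).getD L 0)
        = C ((2 : ℤ) ^ L) := by
      rw [List.getD_eq_getElem _ _ (by simp)]
      simp
    simp only [ArithCircuit.Gate.eval, List.map_cons, List.map_nil, List.sum_cons, List.sum_nil,
      ArithCircuit.Operand.eval, one_smul, add_zero, List.cons.injEq, and_true]
    rw [hget, ← C_add]
    congr 1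
    ring

/-- Every gate of the doubling chain is a sum gate. [cite: Burgisser2009, §2.2] -/
theorem isProd_eq_false_of_mem_pow2Gates (L : ℕ) :
    ∀ g ∈ (pow2Gates L : List (ArithCircuit.Gate ℤ τ)), g.isProd = false := by
  induction L with
  | zero => intro g hg; simp [pow2Gates] at hg; subst hg; rfl
  | succ L ih =>
    intro g hg
    simp only [pow2Gates, List.mem_append, List.mem_singleton] at hg
    rcases hg with hg | rfl
    · exact ih g hg
    · rfl

/-- The doubling chain has sign constants. [cite: Burgisser2009, §2.2] -/
theorem hasSignConstants_of_mem_pow2Gates (L : ℕ) :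
    ∀ g ∈ (pow2Gates L : List (ArithCircuit.Gate ℤ τ)), g.HasSignConstants := by
  induction L with
  | zero =>
    intro g hg
    simp [pow2Gates] at hg
    subst hg
    intro a ha
    simp at ha
    subst ha
    exact ⟨ArithCircuit.isSignConstant_one, ArithCircuit.isSignConstant_one⟩
  | succ L ih =>
    intro g hg
    simp only [pow2Gates, List.mem_append, List.mem_singleton] at hg
    rcases hg with hg | rfl
    · exact ih g hg
    · intro a ha
      simp only [List.mem_cons, List.not_mem_nil, or_false] at ha
      rcases ha with rfl | rfl
      · exact ⟨ArithCircuit.isSignConstant_one, trivial⟩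
      · exact ⟨ArithCircuit.isSignConstant_one, trivial⟩

/-- The doubling chain has `2L + 1` wires. [cite: Burgisser2009, §2.2] -/
theorem sum_fanIn_pow2Gates (L : ℕ) :
    ((pow2Gates L : List (ArithCircuit.Gate ℤ τ)).map ArithCircuit.Gate.fanIn).sum = 2 * L + 1 := by
  induction L with
  | zero => rfl
  | succ L ih =>
    rw [pow2Gates, List.map_append, List.sum_append, ih]
    simp [ArithCircuit.Gate.fanIn, ArithCircuit.Gate.args]
    ring

/-- **Binary numeral** for an integer `z` of bit length `≤ L` (i.e. `|z| ≤ 2^L`): the doubling chain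
followed by ONE sum gate `∑_{j ∈ bits |z|} sign(z) · g_j`; its output is that gate. Sum gates only,
constants and coefficients in `{0, 1, -1}` (Bürgisser 2009, §2.2, `τ(k) ≤ 2 log₂ k`, here in the
unbounded-fan-in, product-depth-`0` form). [cite: Burgisser2009, §2.2] -/
def binNumeral (z : ℤ) (L : ℕ) : ArithCircuit ℤ τ where
  gates := pow2Gates L ++ [.sum (z.natAbs.bitIndices.map fun j => (z.sign, .gate j))]
  output := .gate (L + 1)

/-- The sign of an integer is a sign constant. [folklore] -/
theorem isSignConstant_sign (z : ℤ) : ArithCircuit.IsSignConstant z.sign := by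
  unfold ArithCircuit.IsSignConstant
  rcases lt_trichotomy z 0 with h | rfl | h
  · right; right; rw [Int.sign_eq_neg_one_of_neg h]; norm_num
  · left; simp
  · right; left; exact Int.sign_eq_one_of_pos h

/-- Summing `s · 2^j` over a list of exponents inside `C`. [folklore] -/
theorem sum_map_smul_C_two_pow (s : ℤ) (l : List ℕ) :
    (l.map fun j => s • (C ((2 : ℤ) ^ j) : MvPolynomial τ ℤ)).sum =
      C (s * (((l.map fun j => 2 ^ j).sum : ℕ) : ℤ)) := by
  induction l with
  | nil => simp
  | cons j l ih =>
    rw [List.map_cons, List.sum_cons, ih, List.map_cons, List.sum_cons, Nat.cast_add, mul_add, C_add]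
    congr 1
    rw [smul_eq_C_mul, ← C_mul, Nat.cast_pow, Nat.cast_ofNat]

/-- A number `≤ 2^L` has at most `L + 1` binary digits equal to `1`. [folklore] -/
theorem length_bitIndices_le {N L : ℕ} (h : N ≤ 2 ^ L) : N.bitIndices.length ≤ L + 1 := by
  rw [← List.toFinset_card_of_nodup Nat.bitIndices_nodup, ← Finset.card_range (L + 1)]
  refine Finset.card_le_card fun j hj => ?_
  rw [List.mem_toFinset] at hj
  rw [Finset.mem_range]
  have h2 : 2 ^ j ≤ 2 ^ L := (Nat.two_pow_le_of_mem_bitIndices hj).trans h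
  exact Nat.lt_succ_of_le ((Nat.pow_le_pow_iff_right (by norm_num)).1 h2)

/-- **The binary numeral computes `z`** (for `|z| ≤ 2^L`). [cite: Burgisser2009, §2.2] -/
theorem eval_binNumeral {z : ℤ} {L : ℕ} (hz : z.natAbs ≤ 2 ^ L) :
    (binNumeral z L : ArithCircuit ℤ τ).eval = C z := by
  unfold ArithCircuit.eval
  simp only [binNumeral]
  rw [ArithCircuit.gateValues_append_singleton, gateValues_pow2Gates]
  set vals := (List.range (L + 1)).map fun j => (C ((2 : ℤ) ^ j) : MvPolynomial τ ℤ) with hvals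
  have hlen : vals.length = L + 1 := by simp [hvals]
  simp only [ArithCircuit.Operand.eval]
  rw [List.getD_eq_getElem _ _ (by simp [hlen]), List.getElem_append_right (by simp [hlen])]
  simp only [hlen, Nat.sub_self, List.getElem_cons_zero]
  simp only [ArithCircuit.Gate.eval, List.map_map]
  have hcongr : (z.natAbs.bitIndices.map
      ((fun a : ℤ × ArithCircuit.Operand ℤ τ => a.1 • a.2.eval vals) ∘
        fun j => (z.sign, ArithCircuit.Operand.gate j))) =
      z.natAbs.bitIndices.map fun j => z.sign • (C ((2 : ℤ) ^ j) : MvPolynomial τ ℤ) := by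
    refine List.map_congr_left fun j hj => ?_
    have hjL : j < L + 1 := by
      have h2 : 2 ^ j ≤ 2 ^ L := (Nat.two_pow_le_of_mem_bitIndices hj).trans hz
      exact Nat.lt_succ_of_le ((Nat.pow_le_pow_iff_right (by norm_num)).1 h2)
    simp only [Function.comp_apply, ArithCircuit.Operand.eval]
    rw [List.getD_eq_getElem _ _ (by simpa [hlen] using hjL)]
    simp [hvals]
  rw [hcongr, sum_map_smul_C_two_pow, Nat.sum_map_two_pow_bitIndices, Int.sign_mul_natAbs]

/-- The binary numeral has sign constants. [cite: Burgisser2009, §2.2] -/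
theorem hasSignConstants_binNumeral (z : ℤ) (L : ℕ) :
    (binNumeral z L : ArithCircuit ℤ τ).HasSignConstants := by
  refine ⟨fun g hg => ?_, trivial⟩
  simp only [binNumeral, List.mem_append, List.mem_singleton] at hg
  rcases hg with hg | rfl
  · exact hasSignConstants_of_mem_pow2Gates L g hg
  · intro a ha
    rw [List.mem_map] at ha
    obtain ⟨j, -, rfl⟩ := ha
    exact ⟨isSignConstant_sign z, trivial⟩

/-- If every gate has weight `0`, every weighted depth is `0`. [cite: LST2021, §2] -/
theorem gateWDepths_eq_zero_of_weight_zero {k : Type*} {σ : Type*} (w : ArithCircuit.Gate k σ → ℕ)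
    (gs : List (ArithCircuit.Gate k σ)) (hw : ∀ g ∈ gs, w g = 0) :
    ∀ d ∈ ArithCircuit.gateWDepths w gs, d = 0 := by
  induction gs using List.reverseRecOn with
  | nil => simp [ArithCircuit.gateWDepths]
  | append_singleton gs g ih =>
    intro d hd
    rw [ArithCircuit.gateWDepths_append_singleton] at hd
    have hw' : ∀ g' ∈ gs, w g' = 0 := fun g' hg' => hw g' (List.mem_append_left _ hg')
    have ih' := ih hw'
    simp only [List.mem_append, List.mem_singleton] at hd
    rcases hd with hd | rfl
    · exact ih' d hd
    · rw [hw g (List.mem_append_right _ (List.mem_singleton_self g)), zero_add]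
      have hop : ∀ u : ArithCircuit.Operand k σ,
          u.depthIn (ArithCircuit.gateWDepths w gs) = 0 := by
        intro u
        cases u with
        | var i => rfl
        | const c => rfl
        | gate j =>
          simp only [ArithCircuit.Operand.depthIn, List.getD_eq_getElem?_getD]
          cases h : (ArithCircuit.gateWDepths w gs)[j]? with
          | none => rfl
          | some x => exact ih' x (List.mem_of_getElem? h)
      have hl : ∀ l : List (ArithCircuit.Operand k σ),
          (l.map (ArithCircuit.Operand.depthIn (ArithCircuit.gateWDepths w gs))).foldr max 0 = 0 := by
        intro l
        induction l with
        | nil => rfl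
        | cons u l ihl => simp [hop u, ihl]
      exact hl g.args

/-- **The binary numeral has product depth `0`** (sum gates only). [cite: LST2021, §2] -/
theorem productDepth_binNumeral (z : ℤ) (L : ℕ) :
    (binNumeral z L : ArithCircuit ℤ τ).productDepth = 0 := by
  have h0 := gateWDepths_eq_zero_of_weight_zero
    (fun g : ArithCircuit.Gate ℤ τ => if g.isProd then 1 else 0) (binNumeral z L).gates (by
      intro g hg
      simp only [binNumeral, List.mem_append, List.mem_singleton] at hg
      rcases hg with hg | rfl
      · simp [isProd_eq_false_of_mem_pow2Gates L g hg]
      · rfl)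
  unfold ArithCircuit.productDepth ArithCircuit.wdepth
  show (ArithCircuit.Operand.gate (L + 1) : ArithCircuit.Operand ℤ τ).depthIn _ = 0
  simp only [ArithCircuit.Operand.depthIn, List.getD_eq_getElem?_getD]
  cases h : (ArithCircuit.gateWDepths (fun g : ArithCircuit.Gate ℤ τ => if g.isProd then 1 else 0)
      (binNumeral z L).gates)[L + 1]? with
  | none => rfl
  | some x => exact h0 x (List.mem_of_getElem? h)

/-- **The binary numeral has `≤ 3L + 2` wires** (for `|z| ≤ 2^L`). [cite: Burgisser2009, §2.2] -/
theorem edgeSize_binNumeral_le {z : ℤ} {L : ℕ} (hz : z.natAbs ≤ 2 ^ L) :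
    (binNumeral z L : ArithCircuit ℤ τ).edgeSize ≤ 3 * L + 2 := by
  unfold ArithCircuit.edgeSize
  simp only [binNumeral, List.map_append, List.sum_append, sum_fanIn_pow2Gates, List.map_singleton,
    List.sum_singleton]
  have : (ArithCircuit.Gate.sum (z.natAbs.bitIndices.map fun j => (z.sign, ArithCircuit.Operand.gate j))
      : ArithCircuit.Gate ℤ τ).fanIn ≤ L + 1 := by
    simp only [ArithCircuit.Gate.fanIn, ArithCircuit.Gate.args, List.length_map]
    exact length_bitIndices_le hz
  omega

end Numerals

/-! ### §2 Composition keeps sign constants; eliminating integer advice -/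

/-- Composition of circuits with sign constants has sign constants. [cite: Burgisser2000, Rem. 2.7] -/
theorem hasSignConstants_compose {k : Type*} [Zero k] [One k] [Add k] {σ τ : Type*} [Fintype σ]
    {P : ArithCircuit k σ} (hP : P.HasSignConstants) {Q : σ → ArithCircuit k τ}
    (hQ : ∀ i, (Q i).HasSignConstants) : (P.compose Q).HasSignConstants := by
  have hL : ∀ R ∈ ArithCircuit.compList Q, R.HasSignConstants := fun R hR => by
    rw [ArithCircuit.compList, List.mem_ofFn] at hR
    obtain ⟨j, rfl⟩ := hR
    exact hQ _
  exact hP.substCircuit (ArithCircuit.hasSignConstants_juxtGates hL) fun i =>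
    ArithCircuit.hasSignConstants_juxtOuts hL _ (List.getElem_mem _)

/-- **Integer advice of bit length `L` is free at fixed product depth** (circuit form): a
sign-constant circuit `C(x, y)` with `m` advice inputs `y` fed integers `a i`, `|a i| ≤ 2^L`, is
simulated — same polynomial, product depth not larger, at most `m (3L + 2)` extra wires — by a
sign-constant circuit in the inputs `x` alone (plug the binary numerals `binNumeral (a i) L` into
the advice inputs; Koiran–Perifel 2011 §2, Bürgisser 2009 §2.2). [cite: KoiranPerifel2011, §2] -/
theorem exists_signConst_of_intAdvice {σ : Type} [Fintype σ] {m L : ℕ} (a : Fin m → ℤ)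
    (ha : ∀ i, (a i).natAbs ≤ 2 ^ L) (C : ArithCircuit ℤ (σ ⊕ Fin m)) (hC : C.HasSignConstants) :
    ∃ C₀ : ArithCircuit ℤ σ, C₀.HasSignConstants ∧
      C₀.eval = (C.substVC (Sum.elim Sum.inl fun i => Sum.inr (a i))).eval ∧
      C₀.productDepth ≤ C.productDepth ∧ C₀.edgeSize ≤ C.edgeSize + m * (3 * L + 2) := by
  classical
  let Q : σ ⊕ Fin m → ArithCircuit ℤ σ :=
    Sum.elim (fun v => ArithCircuit.ofVar v) fun i => binNumeral (a i) L
  refine ⟨C.compose Q, hasSignConstants_compose hC ?_, ?_, ?_, ?_⟩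
  · rintro (v | i)
    · exact ArithCircuit.HasSignConstants.ofVar v
    · exact hasSignConstants_binNumeral (a i) L
  · rw [ArithCircuit.eval_compose, ArithCircuit.eval_substVC]
    have hfg : (fun x => (Q x).eval) =
        ArithCircuit.substVCFun (Sum.elim Sum.inl fun i => Sum.inr (a i) : σ ⊕ Fin m → σ ⊕ ℤ) := by
      funext x
      rcases x with v | i
      · simp [Q, ArithCircuit.substVCFun, ArithCircuit.eval_ofVar]
      · simp [Q, ArithCircuit.substVCFun, eval_binNumeral (ha i)]
    rw [hfg]
  · have h := ArithCircuit.productDepth_compose_le (Q := Q) (D := 0) (fun x => ?_) C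
    · simpa using h
    rcases x with v | i
    · exact Nat.le_of_eq rfl
    · exact Nat.le_of_eq (productDepth_binNumeral (a i) L)
  · rw [ArithCircuit.edgeSize_compose, Fintype.sum_sum_type]
    have h0 : ∑ v : σ, (Q (Sum.inl v)).edgeSize = 0 :=
      Finset.sum_eq_zero fun v _ => rfl
    have h1 : ∑ i : Fin m, (Q (Sum.inr i)).edgeSize ≤ m * (3 * L + 2) :=
      calc ∑ i : Fin m, (Q (Sum.inr i)).edgeSize ≤ ∑ _i : Fin m, (3 * L + 2) :=
            Finset.sum_le_sum fun i _ => edgeSize_binNumeral_le (ha i)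
        _ = m * (3 * L + 2) := by simp
    omega

end Summit.ValiantsHypothesis.ValiantsHypothesis.Theorems.SuccinctLift
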